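import Mathlib
import Literature.AlgebraicGeometry.Resolution.PowerSeriesPBasis
import HarnessLib

/-!
# Crux `NarrowRunsDie` (stmt-ResolutionOfSingularities-16882, route `WildCones`), line `derivlift` —
# stub `stub_coset`

Registered stub of the line skeleton `Cruxes/NarrowRunsDie/Lines/derivlift.lean` (v3), stated over the
route's inlined `let` calculus VERBATIM. See the skeleton docstring of `Sig.stub_coset` for the paper proof.

Proof (induction on `m`): `Φ_0 a₀ = a₀ = 1^p a₀ + 0^p`; and `Φ_{m+1} a₀ = σ(Φ_m a₀) =
σ(π_m)^p σ(a_m) + σ(b)^p` (`σ = sub (i m) (t m)` is a ring endomorphism), where the ONE-STEP fact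
`σ(a_m) = X_{i m}^p (a_{m+1} + g^p)` comes from: `MultP (run m)` ⇒ the step divides by `u_i^p`;
the dictionary `σ(Ser (clean (run m))) = X_i^p Ser c'`; `Ser c' = Ser (clean c') + P` with `P` the
`p`-divisible part of `c'`, a `p`-th power over the perfect field `κ`
(`Literature.AlgebraicGeometry.Resolution.exists_pow_eq_of_forall_coeff`); and finally
`(x + y)^p = x^p + y^p` in characteristic `p`.
-/

noncomputable section

set_option linter.dupNamespace false

namespace Summit.ResolutionOfSingularities.ResolutionOfSingularities.Theorems.NarrowRunsDie

/-- The substitution family of `sub i τ` (the `let` text verbatim: `X i ↦ X i` and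
`X j ↦ X i * (X j + C (τ j))` for `j ≠ i`) has zero constant coefficients, hence `HasSubst`
(so `sub i τ` is the `κ`-algebra endomorphism `MvPowerSeries.substAlgHom`). -/
theorem coset_fam_hasSubst {n : ℕ} {κ : Type} [Field κ] (i : Fin n) (τ : Fin n → κ) :
    MvPowerSeries.HasSubst (fun j : Fin n => @ite (MvPowerSeries (Fin n) κ) (j = i)
      (Classical.dec _) (MvPowerSeries.X i)
        (MvPowerSeries.X i * (MvPowerSeries.X j + MvPowerSeries.C (τ j)))) :=
  MvPowerSeries.hasSubst_of_constantCoeff_zero (fun j => by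
    by_cases h : j = i
    · rw [if_pos h]; simp
    · rw [if_neg h]; simp)

/-- Over a perfect field of characteristic `p`, the `p`-divisible part (monomials all of whose
exponents are divisible by `p`) of any coefficient function is the `p`-th power of a power series:
take `p`-th roots of the coefficients (Frobenius is onto) and divide the exponents by `p`. -/
theorem coset_exists_pow_eq (p : ℕ) [Fact p.Prime] {n : ℕ} (κ : Type) [Field κ] [CharP κ p]
    [PerfectField κ] (c : (Fin n → ℕ) → κ) :
    ∃ g : MvPowerSeries (Fin n) κ,
      g ^ p = (show MvPowerSeries (Fin n) κ from
        fun A : Fin n →₀ ℕ => @ite κ (∀ j, p ∣ A j) (Classical.dec _) (c ⇑A) 0) := by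
  refine Literature.AlgebraicGeometry.Resolution.exists_pow_eq_of_forall_coeff p _ ?_ ?_
  · intro A
    exact ⟨_, frobeniusEquiv_symm_pow_p κ p _⟩
  · rintro A ⟨j, hj⟩
    show @ite κ (∀ j, p ∣ A j) (Classical.dec _) (c ⇑A) 0 = 0
    rw [if_neg fun h => hj (h j)]

/-! ## The registered stub signature, by name (`Sig.stub_dict → …`, copied VERBATIM from the line
skeleton `Cruxes/NarrowRunsDie/Lines/derivlift.lean` v3; `private` so that sibling stub files can do
the same without name clashes — the statements unfold definitionally to the skeleton's). -/

/-- Registered signature `Sig.stub_dict` of the line skeleton (VERBATIM copy): the one-blow-up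
dictionary `σ_{i,τ}(Ser a) = X_i^s · Ser (tr i τ s (dv i s (bl i a)))` for a coefficient function `a`
vanishing in total degree `< s` — the HYPOTHESIS of `stub_coset` (proved by the stub `stub_dict`). -/
private def Sig.stub_dict : Prop :=
  ∀ (n : ℕ) (κ : Type) [Field κ] (a : (Fin n → ℕ) → κ) (i : Fin n) (τ : Fin n → κ) (s : ℕ),
    let bl : Fin n → ((Fin n → ℕ) → κ) → ((Fin n → ℕ) → κ) := fun i c B => @ite κ (Finset.sum (Finset.univ.erase i) (fun j => B j) ≤ B i) (Classical.dec _) (c (Function.update B i (B i - Finset.sum (Finset.univ.erase i) (fun j => B j)))) 0;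
    let dv : Fin n → ℕ → ((Fin n → ℕ) → κ) → ((Fin n → ℕ) → κ) := fun i s c B => c (Function.update B i (B i + s));
    let tr : Fin n → (Fin n → κ) → ℕ → ((Fin n → ℕ) → κ) → ((Fin n → ℕ) → κ) := fun i τ s c B => Finset.sum (Fintype.piFinset (fun _ : Fin n => Finset.range (B i + s + 1))) (fun D => @ite κ (D i = 0) (Classical.dec _) (c (B + D) * Finset.prod (Finset.univ.erase i) (fun j => ((Nat.choose (B j + D j) (B j) : ℕ) : κ) * τ j ^ (D j))) 0);
    let sub : Fin n → (Fin n → κ) → MvPowerSeries (Fin n) κ → MvPowerSeries (Fin n) κ := fun i τ f => MvPowerSeries.subst (fun j : Fin n => @ite (MvPowerSeries (Fin n) κ) (j = i) (Classical.dec _) (MvPowerSeries.X i) (MvPowerSeries.X i * (MvPowerSeries.X j + MvPowerSeries.C (τ j)))) f;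
    (∀ A, a A ≠ 0 → s ≤ Finset.sum Finset.univ (fun j => A j)) →
    sub i τ (show MvPowerSeries (Fin n) κ from fun A : Fin n →₀ ℕ => a ⇑A) =
      MvPowerSeries.X i ^ s *
        (show MvPowerSeries (Fin n) κ from fun A : Fin n →₀ ℕ => tr i τ s (dv i s (bl i a)) ⇑A)

/-- Registered signature `Sig.stub_coset` of the line skeleton (VERBATIM copy): along a run all of
whose states have multiplicity `p`, `Φ_m(a₀) = π_m^p · a_m + b^p` in `κ⟦u⟧`, where `a_m = ser (run m)`,
`Φ_m` is the composite substitution of the word and `π_m` the pushed-forward product of exceptional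
variables. -/
private def Sig.stub_coset : Prop :=
  Sig.stub_dict →
  ∀ p : ℕ, p.Prime → ∀ n : ℕ, 0 < n → ∀ (κ : Type) [Field κ] [CharP κ p] [PerfectField κ]
    (c₀ : (Fin n → ℕ) → κ) (i : ℕ → Fin n) (t : ℕ → Fin n → κ),
    let clean : ((Fin n → ℕ) → κ) → ((Fin n → ℕ) → κ) := fun c A => @ite κ (∀ j, p ∣ A j) (Classical.dec _) 0 (c A);
    let bl : Fin n → ((Fin n → ℕ) → κ) → ((Fin n → ℕ) → κ) := fun i c B => @ite κ (Finset.sum (Finset.univ.erase i) (fun j => B j) ≤ B i) (Classical.dec _) (c (Function.update B i (B i - Finset.sum (Finset.univ.erase i) (fun j => B j)))) 0;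
    let ord : ((Fin n → ℕ) → κ) → ℕ := fun c => sInf {m : ℕ | ∃ A, c A ≠ 0 ∧ m = Finset.sum Finset.univ (fun j => A j)};
    let dv : Fin n → ℕ → ((Fin n → ℕ) → κ) → ((Fin n → ℕ) → κ) := fun i s c B => c (Function.update B i (B i + s));
    let tr : Fin n → (Fin n → κ) → ℕ → ((Fin n → ℕ) → κ) → ((Fin n → ℕ) → κ) := fun i τ s c B => Finset.sum (Fintype.piFinset (fun _ : Fin n => Finset.range (B i + s + 1))) (fun D => @ite κ (D i = 0) (Classical.dec _) (c (B + D) * Finset.prod (Finset.univ.erase i) (fun j => ((Nat.choose (B j + D j) (B j) : ℕ) : κ) * τ j ^ (D j))) 0);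
    let step : Fin n → (Fin n → κ) → ((Fin n → ℕ) → κ) → ((Fin n → ℕ) → κ) := fun i τ c => clean (tr i τ (@ite ℕ (p ≤ ord (clean c)) (Classical.dec _) p 0) (dv i (@ite ℕ (p ≤ ord (clean c)) (Classical.dec _) p 0) (bl i (clean c))));
    let run : ((Fin n → ℕ) → κ) → (ℕ → Fin n) → (ℕ → Fin n → κ) → ℕ → ((Fin n → ℕ) → κ) := fun c₀ i t m => @Nat.rec (fun _ => (Fin n → ℕ) → κ) c₀ (fun m c => step (i m) (t m) c) m;
    let ser : ((Fin n → ℕ) → κ) → MvPowerSeries (Fin n) κ := fun c => show MvPowerSeries (Fin n) κ from fun A : Fin n →₀ ℕ => clean c ⇑A;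
    let MultP : ((Fin n → ℕ) → κ) → Prop := fun c => (∃ A, clean c A ≠ 0) ∧ ∀ A, clean c A ≠ 0 → p ≤ Finset.sum Finset.univ (fun j => A j);
    let sub : Fin n → (Fin n → κ) → MvPowerSeries (Fin n) κ → MvPowerSeries (Fin n) κ := fun i τ f => MvPowerSeries.subst (fun j : Fin n => @ite (MvPowerSeries (Fin n) κ) (j = i) (Classical.dec _) (MvPowerSeries.X i) (MvPowerSeries.X i * (MvPowerSeries.X j + MvPowerSeries.C (τ j)))) f;
    let Phi : ℕ → MvPowerSeries (Fin n) κ → MvPowerSeries (Fin n) κ := fun m f => @Nat.rec (fun _ => MvPowerSeries (Fin n) κ) f (fun k g => sub (i k) (t k) g) m;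
    let piE : ℕ → MvPowerSeries (Fin n) κ := fun m => @Nat.rec (fun _ => MvPowerSeries (Fin n) κ) 1 (fun k g => MvPowerSeries.X (i k) * sub (i k) (t k) g) m;
    (∀ m, MultP (run c₀ i t m)) →
    ∀ m, ∃ b : MvPowerSeries (Fin n) κ,
      Phi m (ser (run c₀ i t 0)) = piE m ^ p * ser (run c₀ i t m) + b ^ p

/-- Stub `stub_coset` of line `derivlift` for crux `WildCones.NarrowRunsDie` (registered signature
`Sig.stub_coset`, by name; it unfolds to the skeleton's statement verbatim). -/
theorem stub_coset : Sig.stub_coset := by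
  intro hd p hp n _ κ _ _ _ c₀ i t clean bl ord dv tr step run ser MultP sub Phi piE hmult m
  haveI : Fact p.Prime := ⟨hp⟩
  haveI : CharP (MvPowerSeries (Fin n) κ) p :=
    charP_of_injective_ringHom (f := (MvPowerSeries.C : κ →+* MvPowerSeries (Fin n) κ))
      MvPowerSeries.C_injective p
  -- `sub j τ` is a ring endomorphism (its substitution family has `HasSubst`)
  have hσadd : ∀ (j : Fin n) (τ : Fin n → κ) (f g : MvPowerSeries (Fin n) κ),
      sub j τ (f + g) = sub j τ f + sub j τ g :=
    fun j τ f g => MvPowerSeries.subst_add (coset_fam_hasSubst j τ) f g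
  have hσmul : ∀ (j : Fin n) (τ : Fin n → κ) (f g : MvPowerSeries (Fin n) κ),
      sub j τ (f * g) = sub j τ f * sub j τ g :=
    fun j τ f g => MvPowerSeries.subst_mul (coset_fam_hasSubst j τ) f g
  have hσpow : ∀ (j : Fin n) (τ : Fin n → κ) (f : MvPowerSeries (Fin n) κ) (k : ℕ),
      sub j τ (f ^ k) = sub j τ f ^ k :=
    fun j τ f k => MvPowerSeries.subst_pow (coset_fam_hasSubst j τ) f k
  -- KEY ONE-STEP FACT: `σ_m(a_m) = X_{i m}^p * (a_{m+1} + g^p)`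
  have hkey : ∀ m : ℕ, ∃ g : MvPowerSeries (Fin n) κ,
      sub (i m) (t m) (ser (run c₀ i t m)) =
        MvPowerSeries.X (i m) ^ p * (ser (run c₀ i t (m + 1)) + g ^ p) := by
    intro m
    have hm : (∃ A, clean (run c₀ i t m) A ≠ 0) ∧
        ∀ A, clean (run c₀ i t m) A ≠ 0 → p ≤ Finset.sum Finset.univ (fun j => A j) := hmult m
    obtain ⟨⟨A₀, hA₀⟩, hbound⟩ := hm
    -- (a) `MultP (run m)` ⇒ `p ≤ ord (clean (run m))`, so the step divides by `u_i^p`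
    have hpo : p ≤ ord (clean (run c₀ i t m)) := by
      show p ≤ sInf {m' : ℕ | ∃ A, clean (run c₀ i t m) A ≠ 0 ∧
        m' = Finset.sum Finset.univ (fun j => A j)}
      exact le_csInf ⟨Finset.sum Finset.univ (fun j => A₀ j), A₀, hA₀, rfl⟩
        (by rintro _ ⟨A, hA, rfl⟩; exact hbound A hA)
    have hrun : run c₀ i t (m + 1) =
        clean (tr (i m) (t m) p (dv (i m) p (bl (i m) (clean (run c₀ i t m))))) := by
      show clean (tr (i m) (t m) (@ite ℕ (p ≤ ord (clean (run c₀ i t m))) (Classical.dec _) p 0)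
        (dv (i m) (@ite ℕ (p ≤ ord (clean (run c₀ i t m))) (Classical.dec _) p 0)
          (bl (i m) (clean (run c₀ i t m))))) = _
      rw [if_pos hpo]
    -- (b) the dictionary at `a := clean (run m)`, `s := p`
    have hdict : sub (i m) (t m) (ser (run c₀ i t m)) = MvPowerSeries.X (i m) ^ p *
        (show MvPowerSeries (Fin n) κ from fun A : Fin n →₀ ℕ =>
          tr (i m) (t m) p (dv (i m) p (bl (i m) (clean (run c₀ i t m)))) ⇑A) :=
      hd n κ (clean (run c₀ i t m)) (i m) (t m) p hbound
    -- (d) the `p`-divisible part of `c'` is a `p`-th power over the perfect field `κ`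
    obtain ⟨g, hg⟩ := coset_exists_pow_eq p κ
      (tr (i m) (t m) p (dv (i m) p (bl (i m) (clean (run c₀ i t m)))))
    refine ⟨g, ?_⟩
    rw [hdict, hg]
    congr 1
    -- (c) `clean` is idempotent: `Ser c' = Ser (clean (clean c')) + (p-divisible part of c')`
    apply MvPowerSeries.ext
    intro A
    rw [map_add]
    show tr (i m) (t m) p (dv (i m) p (bl (i m) (clean (run c₀ i t m)))) ⇑A =
      clean (run c₀ i t (m + 1)) ⇑A +
        @ite κ (∀ j, p ∣ A j) (Classical.dec _)
          (tr (i m) (t m) p (dv (i m) p (bl (i m) (clean (run c₀ i t m)))) ⇑A) 0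
    rw [hrun]
    show _ = @ite κ (∀ j, p ∣ A j) (Classical.dec _) 0 (@ite κ (∀ j, p ∣ A j) (Classical.dec _) 0
        (tr (i m) (t m) p (dv (i m) p (bl (i m) (clean (run c₀ i t m)))) ⇑A)) + _
    by_cases h : ∀ j, p ∣ (A : Fin n → ℕ) j
    · simp only [if_pos h, zero_add]
    · simp only [if_neg h, add_zero]
  -- INDUCTION on `m`
  induction m with
  | zero =>
    refine ⟨0, ?_⟩
    show ser (run c₀ i t 0) = 1 ^ p * ser (run c₀ i t 0) + 0 ^ p
    rw [one_pow, one_mul, zero_pow hp.ne_zero, add_zero]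
  | succ m ih =>
    obtain ⟨b, hb⟩ := ih
    obtain ⟨g, hg⟩ := hkey m
    refine ⟨MvPowerSeries.X (i m) * sub (i m) (t m) (piE m) * g + sub (i m) (t m) b, ?_⟩
    show sub (i m) (t m) (Phi m (ser (run c₀ i t 0))) =
      (MvPowerSeries.X (i m) * sub (i m) (t m) (piE m)) ^ p * ser (run c₀ i t (m + 1)) +
        (MvPowerSeries.X (i m) * sub (i m) (t m) (piE m) * g + sub (i m) (t m) b) ^ p
    rw [hb, hσadd, hσmul, hσpow, hσpow, hg,
      add_pow_char (x := MvPowerSeries.X (i m) * sub (i m) (t m) (piE m) * g)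
        (y := sub (i m) (t m) b)]
    ring

end Summit.ResolutionOfSingularities.ResolutionOfSingularities.Theorems.NarrowRunsDie

end
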